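import Summits.RiemannHypothesis.RiemannHypothesis.Theorems.SpectralTracePickSlopeDefs
import Summits.RiemannHypothesis.RiemannHypothesis.Theses.SpectralTrace
import Summits.RiemannHypothesis.RiemannHypothesis.Theorems.WindowTracePrime2.Negative.FiniteFamilies

/-!
# RiemannHypothesis / SpectralTrace — stub `stub_pickSlopeOfCrux` of the line `pick-slope`

Crux item `WindowTracePrime2` (stmt-RiemannHypothesis-11196), route `RiemannHypothesis/SpectralTrace`, line
`pick-slope`. This file proves the registered stub `stub_pickSlopeOfCrux`, the LOSSLESSNESS direction of the
line's reformulation: the mass law (taken as a hypothesis; it is the statement of the neighbouring stub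
`stub_massLaw`) and ANY witness `γ : ι → ℝ` of the crux give, for every Nevanlinna parametrisation `R`
(`Resolvent.IsNevanlinna`, definitions file `Theorems/SpectralTracePickSlopeDefs.lean`), a parameter `p` whose
predicted reciprocal masses `R.invMass p x` at all crossings `x ∈ R.atoms p` are reciprocals of positive
integers.

Proof. (1) Every witness is locally finite with finite fibres (landed:
`WindowTracePrime2.Negative.finite_abs_le_of_trace`, `finite_fibre_of_trace`). (2) Regroup the witness along the
fibres of `γ` (`Equiv.sigmaFiberEquiv`, `HasSum.sigma`): the atom set `S = range γ` with the multiplicities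
`m₀ x = #{i | γ i = x} ≥ 1` is a positive-integer-weighted locally finite realisation (`Realises S m₀`).
(3) `complete` labels it by a parameter `p` with `supp p = S`, `mass p = m₀` on `S`. (4) `invMass p > 0`
everywhere (`κ > 0`, `c_k > 0`, `a ≥ 0`, squares). (5) At a crossing `x` the mass law gives the punctured limit
`(invMass p x)⁻¹ ≠ 0` of `(x - t) m_p(t)`, while `residue` gives the limit `𝟙_S(x) · mass p x`; uniqueness of
limits along `𝓝[≠] x` forces `x ∈ S` and `invMass p x = (m₀ x)⁻¹`.
-/

noncomputable section

open Complex Filter Set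
open scoped Topology

set_option linter.dupNamespace false

namespace Summit.RiemannHypothesis.RiemannHypothesis.Theorems.PickSlope

open Literature.NumberTheory.LFunctions
open Summit.RiemannHypothesis.RiemannHypothesis.Theorems.WindowTracePrime2.Negative
  (finite_abs_le_of_trace finite_fibre_of_trace)

/-- For a Nevanlinna parametrisation the predicted reciprocal mass `invMass p x` is positive at EVERY real
point: it is `κ > 0` plus a non-negative term (`D²/c_k` at a pole of `τ`, `C² τ′` with
`τ′ = a + Σ c_k/(s_k - x)² ≥ 0` off the poles; `κ` alone for `p = ∞`). -/
theorem stub_pickSlopeOfCrux_invMass_pos {R : Resolvent} (hR : R.IsNevanlinna) (p : Option PickParam)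
    (x : ℝ) : 0 < R.invMass p x := by
  have hκ := hR.kappa_pos x
  cases p with
  | none => exact hκ
  | some τ =>
    simp only [Resolvent.invMass]
    split_ifs with hx
    · have hw : 0 < τ.weight x := by
        obtain ⟨k, hk⟩ := hx
        have h : ∃ k, τ.s k = x := ⟨k, hk⟩
        unfold PickParam.weight
        rw [dif_pos h]
        exact τ.c_pos _
      positivity
    · have hs : 0 ≤ τ.slope x :=
        add_nonneg τ.a_nonneg (tsum_nonneg fun k => div_nonneg (τ.c_pos k).le (sq_nonneg _))
      positivity

/-- Regrouping along finite fibres: if `Σ_i F(γ i)` has sum `a` (unconditionally) and every fibre of `γ` is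
finite, then `Σ_{x ∈ range γ} #{i | γ i = x} · F(x)` has sum `a` (`Equiv.sigmaFiberEquiv` + `HasSum.sigma`;
no absolute convergence is needed in this direction). -/
theorem stub_pickSlopeOfCrux_hasSum_fibre {ι : Type} (γ : ι → ℝ) (F : ℝ → ℂ) {a : ℂ}
    (hfin : ∀ x : ℝ, {i : ι | γ i = x}.Finite) (h : HasSum (fun i => F (γ i)) a) :
    HasSum (fun x : Set.range γ => ((Nat.card {i : ι // γ i = x} : ℕ) : ℂ) * F x) a := by
  have h1 : HasSum ((fun i => F (γ i)) ∘ Equiv.sigmaFiberEquiv γ) a :=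
    (Equiv.hasSum_iff (Equiv.sigmaFiberEquiv γ)).2 h
  have h2 : ∀ x : ℝ, HasSum (fun c : {i : ι // γ i = x} =>
      ((fun i => F (γ i)) ∘ Equiv.sigmaFiberEquiv γ) ⟨x, c⟩)
      (((Nat.card {i : ι // γ i = x} : ℕ) : ℂ) * F x) := by
    intro x
    haveI : Fintype {i : ι // γ i = x} := (hfin x).fintype
    have e := hasSum_fintype (fun c : {i : ι // γ i = x} =>
      ((fun i => F (γ i)) ∘ Equiv.sigmaFiberEquiv γ) ⟨x, c⟩)
    have hsum : ∑ c : {i : ι // γ i = x}, ((fun i => F (γ i)) ∘ Equiv.sigmaFiberEquiv γ) ⟨x, c⟩ =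
        ((Nat.card {i : ι // γ i = x} : ℕ) : ℂ) * F x := by
      have hc : ∀ c : {i : ι // γ i = x}, ((fun i => F (γ i)) ∘ Equiv.sigmaFiberEquiv γ) ⟨x, c⟩ = F x := by
        intro c
        show F (γ (c : ι)) = F x
        rw [c.2]
      rw [Finset.sum_congr rfl fun c _ => hc c, Finset.sum_const, Finset.card_univ, nsmul_eq_mul,
        Nat.card_eq_fintype_card]
    rwa [hsum] at e
  have h3 : HasSum (fun x : ℝ => ((Nat.card {i : ι // γ i = x} : ℕ) : ℂ) * F x) a := h1.sigma h2
  refine (hasSum_subtype_iff_of_support_subset ?_).2 h3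
  intro x hx
  rw [Function.mem_support] at hx
  by_contra hxS
  apply hx
  haveI : IsEmpty {i : ι // γ i = x} := ⟨fun c => hxS ⟨c.1, c.2⟩⟩
  rw [Nat.card_of_isEmpty, Nat.cast_zero, zero_mul]

/-- **`stub_pickSlopeOfCrux`** (registered stub of the line `pick-slope`, crux stmt-RiemannHypothesis-11196) —
LOSSLESSNESS of the reformulation: the mass law and ANY witness of the crux `WindowTracePrime2` give, for every
Nevanlinna parametrisation `R`, a parameter `p` and positive integers `m x` with `R.invMass p x = (m x)⁻¹` at
every crossing `x ∈ R.atoms p`. Regroup the witness over the (finite) fibres of `γ` into a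
positive-integer-weighted locally finite realisation, label it by `complete`, and identify `invMass` with `1/m`
by `residue`, the mass law and uniqueness of punctured limits (`invMass > 0` by `kappa_pos`, `c_pos`,
`a_nonneg`). RH-free. -/
theorem stub_pickSlopeOfCrux :
    (∀ (R : Resolvent) (p : Option PickParam) (x : ℝ),
      (x ∈ R.atoms p → R.invMass p x ≠ 0 →
        Tendsto (fun t => (x - t) * R.mfun p t) (𝓝[≠] x) (𝓝 (R.invMass p x)⁻¹)) ∧
      (x ∉ R.atoms p → Tendsto (fun t => (x - t) * R.mfun p t) (𝓝[≠] x) (𝓝 0))) →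
    Summit.RiemannHypothesis.RiemannHypothesis.Theses.SpectralTrace.WindowTracePrime2 →
    ∀ R : Resolvent, R.IsNevanlinna →
      ∃ (p : Option PickParam) (m : ℝ → ℕ), ∀ x ∈ R.atoms p, 0 < m x ∧ R.invMass p x = ((m x : ℝ))⁻¹ := by
  intro hML hcrux R hR
  obtain ⟨ι, γ, hγ⟩ := hcrux
  have hA : (0 : ℝ) < Real.log 3 := Real.log_pos (by norm_num)
  -- (1) finite fibres, local finiteness
  have hfib : ∀ x : ℝ, {i : ι | γ i = x}.Finite := fun x => finite_fibre_of_trace hA hγ x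
  have hloc : ∀ K : ℝ, {i : ι | |γ i| ≤ K}.Finite := fun K => finite_abs_le_of_trace hA hγ K
  -- (2) the regrouped realisation: atoms `S = range γ`, multiplicities `m₀`
  set S : Set ℝ := Set.range γ
  set m₀ : ℝ → ℕ := fun x => Nat.card {i : ι // γ i = x}
  have hm₀pos : ∀ x ∈ S, 0 < m₀ x := by
    rintro x ⟨i, rfl⟩
    haveI : Finite {j : ι // γ j = γ i} := hfib (γ i)
    haveI : Nonempty {j : ι // γ j = γ i} := ⟨⟨i, rfl⟩⟩
    exact Nat.card_pos
  have hwpos : ∀ x ∈ S, (0 : ℝ) < (m₀ x : ℝ) := fun x hx => by exact_mod_cast hm₀pos x hx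
  have hSloc : ∀ K : ℝ, (S ∩ Icc (-K) K).Finite := by
    intro K
    refine ((hloc K).image γ).subset ?_
    rintro x ⟨⟨i, rfl⟩, hK⟩
    exact ⟨i, abs_le.2 ⟨by linarith [hK.1], hK.2⟩, rfl⟩
  have hreal : Realises S (fun x => (m₀ x : ℝ)) := by
    intro g hg hsupp
    have h := stub_pickSlopeOfCrux_hasSum_fibre γ (fun x : ℝ => weilMellin g (1 / 2 + (x : ℂ) * I)) hfib
      (hγ g hg hsupp)
    refine h.congr_fun ?_
    intro x
    push_cast
    rfl
  -- (3) label it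
  obtain ⟨p, hsupp, hmass⟩ := hR.complete S (fun x => (m₀ x : ℝ)) hwpos hSloc hreal
  -- (4)-(5) identify the predicted masses at the crossings
  refine ⟨p, m₀, fun x hxa => ?_⟩
  have hpos := stub_pickSlopeOfCrux_invMass_pos hR p x
  have hlim := (hML R p x).1 hxa hpos.ne'
  have hres := hR.residue p x
  have huniq : (R.supp p).indicator (R.mass p) x = (R.invMass p x)⁻¹ := tendsto_nhds_unique hres hlim
  have hxS : x ∈ S := by
    by_contra hxS
    rw [← hsupp] at hxS
    rw [Set.indicator_of_notMem hxS] at huniq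
    exact (inv_ne_zero hpos.ne') huniq.symm
  refine ⟨hm₀pos x hxS, ?_⟩
  rw [hsupp, Set.indicator_of_mem hxS, hmass x hxS] at huniq
  rw [← inv_inv (R.invMass p x), ← huniq]
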